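import Summits.HodgeConjecture.HodgeConjecture.Theorems.Ring2AbelianAllAndreSporadicClasses
import Summits.HodgeConjecture.HodgeConjecture.Theorems.Ring2AbelianAllAndreInvariantHomNumRank
import HarnessLib

/-!
# Ring 2 · sub-cell AbelianAll (ALL ABELIAN VARIETIES), André axis, part XXXI-c — SPORADIC ALGEBRAIC CLASSES, RANK
# FORM: the rank of the INVARIANT ALGEBRAIC CLASSES `dim (Nᵖ(𝒳_t) ∩ Im j_t^*)` takes one value `r_p(f) = dim j_t^* Nᵖ(𝒳)`
# at all but countably many fibres of a compact pencil, is `≥ r_p(f)` everywhere, and the André-axis lift `(L)_t(p)`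
# holds at `t` EXACTLY when it does not jump there — `B_min` says the CM fibres lie outside the (countable)
# invariant Noether–Lefschetz locus of the pencil (granted Verdier 1976 for the generic value)

HONEST FRAMING (page 1, verbatim): **research route, not a corollary; conditional on HC_CM plus one named
minimal statement.** Cell line: research route conditional on HC_CM; not a corollary; Q11.4-sentence-2 already
refuted in dim ≥ 3. Nothing in this file proves a case of the Hodge conjecture for an abelian variety. `HC_CM`
(`Theses.RankFourFaces.CMAbelianHodge`) is a BINDER in the one row of §4 where it occurs; `hGT` = Verdier's generic
local triviality is a NAMED-FACT BINDER; the reduction item `CMToAbelian` (stmt-HodgeConjecture-16267) is NOT closed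
here; the cell's `B_min` of record (N104) is untouched; NO node is born (0 `def`), nothing is claimed minimal.

## Content (sequel of parts XXXI-a/b and XXX-a/d; `N_t^{inv} := Nᵖ(𝒳_t) ⊓ Im j_t^*`, `r_p(f) := dim j_t^* Nᵖ(𝒳)`)

* §1 (linear algebra) linear maps with the same kernel have images of the same dimension on every subspace.
* §2 (fact-free) **`r_p(f) = dim j_t^* Nᵖ(𝒳)` does not depend on `t`** (`ker j_t^*` does not, part XVII-c) and
  `r_p(f) ≤ dim N_t^{inv}` at every `t` (part XXX-a `map_algebraicClasses_le_inf_range`); `(L)_t(p) ⟺ dim N_t^{inv} = r_p(f)`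
  (part XXX-d `comap_le_sup_iff_finrank_le`).
* §3 [Verdier] **the generic value**: `dim N_s^{inv} = r_p(f)` for all `s` outside a countable set (part XXXI-a §4);
  hence `dim N_s^{inv} ≤ dim N_t^{inv}` for such `s` and every `t` — the invariant algebraic rank is MINIMAL at a very
  general fibre and can only jump UP — and **`(L)_t(p)` ⟺ `dim N_t^{inv} ≤ dim N_s^{inv}` ⟺ `dim N_t^{inv} = dim N_s^{inv}`
  for one (every) `s` outside the countable set ⟺ `{s | dim N_s^{inv} ≠ dim N_t^{inv}}` is countable** (NO JUMP AT `t`).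
* §4 node level: **(L) `CMFibreAlgebraicLift` ⟺ "at every CM point of every compact pencil of abelian varieties the
  invariant algebraic rank is the very general one"** (`cmFibreAlgebraicLift_iff_countable_finrank_ne_of_verdier`);
  under `HC_CM` the CM value is the rank of the invariant HODGE classes (part XXX-d), so `B_min` on `(f, p)` reads
  "very general invariant algebraic rank = invariant Hodge rank" (`comap_le_sup_iff_countable_finrank_hodge_ne_of_HC_CM_of_verdier`).

READING (RING2-MAP §AbelianAll (ab-andre-2, gen 23)). In Noether–Lefschetz language: the INVARIANT part of the
algebraic classes of the fibres has a generic rank and a countable jump locus; the André-axis `B_min` is "CM points are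
not jump points". Unlike the classical Noether–Lefschetz locus (where the Picard rank of the fibre jumps — CM points
ARE in it), only the invariant part `∩ Im j_t^*` is concerned, whose Hodge rank never jumps (theorem of the fixed
part); the question is whether its ALGEBRAIC rank does.

EDGE LABELS: §1–§2 fact-free; §3–§4 K[Verdier] (`hGT` a hypothesis), the last row of §4 also with the `HC_CM` binder.
No `def`, no `sorry`; axioms standard.

References: VoisinHodgeII2003 (§3.3.1–3.3.2 Noether–Lefschetz, §10.2.1); CharlesSchnell2014Notes (Prop. 11.3.11,
Cor. 11.3.6); Verdier1976 (Cor. (5.1)); Andre1996Motifs (§5.1 (A4) p. 25, §6.3 p. 33); DeligneHodgeII1971 (Thm. 4.1.1,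
Cor. 4.1.2); Milne2020HodgeClassesAV (Prop. 1); Kleiman1968AlgebraicCycles (§3).
-/

noncomputable section

set_option linter.dupNamespace false

namespace Summit.HodgeConjecture.HodgeConjecture.Ring2.AbelianAll

open CategoryTheory AlgebraicGeometry
open Literature.AlgebraicGeometry Literature.AlgebraicGeometry.Motives
open Literature.AlgebraicGeometry.HodgeTheory
open Literature.AlgebraicGeometry.Deligne1982 (cmLocus)
open Summit.HodgeConjecture.HodgeConjecture
open Summit.HodgeConjecture.HodgeConjecture.Theses

/-! ## §1 Linear algebra: images of a subspace under maps with the same kernel -/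

section LinearAlgebra

variable {K V W₁ W₂ : Type*} [Field K] [AddCommGroup V] [Module K V] [AddCommGroup W₁] [Module K W₁]
  [AddCommGroup W₂] [Module K W₂]

/-- **Linear maps with the same kernel have images of the same dimension on every subspace** (rank–nullity for the
restrictions to the subspace, whose kernels `N ∩ ker g` coincide). [folklore] -/
theorem finrank_map_eq_of_ker_eq [FiniteDimensional K V] (g₁ : V →ₗ[K] W₁) (g₂ : V →ₗ[K] W₂)
    (h : LinearMap.ker g₁ = LinearMap.ker g₂) (N : Submodule K V) :
    Module.finrank K (N.map g₁) = Module.finrank K (N.map g₂) := by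
  have h₁ := LinearMap.finrank_range_add_finrank_ker (g₁.domRestrict N)
  have h₂ := LinearMap.finrank_range_add_finrank_ker (g₂.domRestrict N)
  rw [LinearMap.range_domRestrict, LinearMap.ker_domRestrict] at h₁ h₂
  rw [h] at h₁
  omega

end LinearAlgebra

variable {𝒳 S : SchemeOver ℂ} {d : ℕ} {f : 𝒳 ⟶ S}

/-! ## §2 The generic invariant algebraic rank `r_p(f) = dim j_t^* Nᵖ(𝒳)` and the lift as "no excess" -/

/-- **`dim j_t^* Nᵖ(𝒳)` does not depend on `t`** on a compact pencil of abelian varieties: the kernels `ker j_t^*`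
coincide (part XVII-c `ker_map_fiberι_eq`, André's flatness (A4)). [cite: Andre1996Motifs, §5.1 (A4) (p. 25)] -/
theorem finrank_map_algebraicClasses_eq (hf : IsCompactAbelianPencil f d) (p : ℕ) (s t : ComplexPoints S) :
    Module.finrank ℂ ↥((algebraicClasses 𝒳 p).map (complexBetti.map (fiberι f s) (2 * p)).hom) =
      Module.finrank ℂ ↥((algebraicClasses 𝒳 p).map (complexBetti.map (fiberι f t) (2 * p)).hom) := by
  haveI : Module.Finite ℂ (complexBetti 𝒳 (2 * p)) := finite_complexBetti hf.isSmoothProjective_total (2 * p)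
  exact finrank_map_eq_of_ker_eq _ _ (ker_map_fiberι_eq hf (2 * p) s t) _

/-- **`r_p(f) ≤ dim N_t^{inv}` at every fibre**: `j_t^* Nᵖ(𝒳) ≤ Nᵖ(𝒳_t) ⊓ Im j_t^*` (part XXX-a). [cite: Fulton1998, §10.1 Cor. 10.1 and §19.2 Cor. 19.2 (b)] -/
theorem finrank_map_le_finrank_inf_range (hf : IsCompactAbelianPencil f d) (t : ComplexPoints S) (p : ℕ) :
    Module.finrank ℂ ↥((algebraicClasses 𝒳 p).map (complexBetti.map (fiberι f t) (2 * p)).hom) ≤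
      Module.finrank ℂ ↥(algebraicClasses (fiberOver f t) p ⊓ LinearMap.range (complexBetti.map (fiberι f t) (2 * p)).hom) := by
  haveI : Module.Finite ℂ (complexBetti (fiberOver f t) (2 * p)) :=
    finite_complexBetti (hf.isSmoothProjective_fiberOver t) (2 * p)
  exact Submodule.finrank_mono (map_algebraicClasses_le_inf_range hf t p)

/-- **`(L)_t(p)` ⟺ `dim N_t^{inv} = r_p(f)`** (no excess invariant algebraic classes at `t`; part XXX-d's rank form
with the inequality closed up by §2). [cite: Milne2020HodgeClassesAV, Prop. 1 (p. 8)] [cite: Kleiman1968AlgebraicCycles, §3] -/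
theorem comap_le_sup_iff_finrank_inf_range_eq (hf : IsCompactAbelianPencil f d) (t : ComplexPoints S) (p : ℕ) :
    (algebraicClasses (fiberOver f t) p).comap (complexBetti.map (fiberι f t) (2 * p)).hom ≤
        algebraicClasses 𝒳 p ⊔ LinearMap.ker (complexBetti.map (fiberι f t) (2 * p)).hom ↔
      Module.finrank ℂ ↥(algebraicClasses (fiberOver f t) p ⊓ LinearMap.range (complexBetti.map (fiberι f t) (2 * p)).hom) =
        Module.finrank ℂ ↥((algebraicClasses 𝒳 p).map (complexBetti.map (fiberι f t) (2 * p)).hom) := by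
  rw [comap_le_sup_iff_finrank_le hf t p]
  exact ⟨fun h ↦ le_antisymm h (finrank_map_le_finrank_inf_range hf t p), fun h ↦ h.le⟩

/-! ## §3 The generic value and the jump criterion, granted Verdier -/

/-- A countable set of complex points of the base of a compact pencil misses a point. [cite: SerreGAGA1956, §2 n°5 Prop. 2 and n°6] -/
theorem exists_not_mem_of_countable (hf : IsCompactAbelianPencil f d) (t : ComplexPoints S) {C : Set (ComplexPoints S)}
    (hC : C.Countable) : ∃ s : ComplexPoints S, s ∉ C := by
  by_contra h
  push Not at h
  exact not_countable_of_forall_mem_of_curve hf.isSmoothProjective_base t h hC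

/-- **THE GENERIC VALUE, granted Verdier: `dim N_s^{inv} = r_p(f)` for all `s` outside a countable set**, in every
degree (part XXXI-a §4 + part XXX-a `inf_range_eq_map_of_comap_le_sup`). [cite: Verdier1976, Cor. (5.1)]
[cite: CharlesSchnell2014Notes, Prop. 11.3.11 (proof)] -/
theorem exists_countable_forall_finrank_inf_range_eq_of_verdier (hGT : Verdier1976_genericLocalTriviality)
    (hf : IsCompactAbelianPencil f d) :
    ∃ E : Set (ComplexPoints S), E.Countable ∧ ∀ s ∉ E, ∀ p : ℕ,
      Module.finrank ℂ ↥(algebraicClasses (fiberOver f s) p ⊓ LinearMap.range (complexBetti.map (fiberι f s) (2 * p)).hom) =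
        Module.finrank ℂ ↥((algebraicClasses 𝒳 p).map (complexBetti.map (fiberι f s) (2 * p)).hom) := by
  obtain ⟨E, hE, h⟩ := exists_countable_forall_comap_le_sup_of_verdier' hGT hf
  exact ⟨E, hE, fun s hs p ↦ (comap_le_sup_iff_finrank_inf_range_eq hf s p).1 (h s hs p)⟩

/-- **THE INVARIANT ALGEBRAIC RANK IS MINIMAL AT A VERY GENERAL FIBRE, granted Verdier**: for `s` outside a countable
set, `dim N_s^{inv} ≤ dim N_t^{inv}` for EVERY `t` — the rank can only jump UP, at countably many fibres.
[cite: Verdier1976, Cor. (5.1)] [cite: VoisinHodgeII2003, §3.3.1] -/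
theorem exists_countable_forall_finrank_inf_range_le_of_verdier (hGT : Verdier1976_genericLocalTriviality)
    (hf : IsCompactAbelianPencil f d) :
    ∃ E : Set (ComplexPoints S), E.Countable ∧ ∀ s ∉ E, ∀ (p : ℕ) (t : ComplexPoints S),
      Module.finrank ℂ ↥(algebraicClasses (fiberOver f s) p ⊓ LinearMap.range (complexBetti.map (fiberι f s) (2 * p)).hom) ≤
        Module.finrank ℂ ↥(algebraicClasses (fiberOver f t) p ⊓ LinearMap.range (complexBetti.map (fiberι f t) (2 * p)).hom) := by
  obtain ⟨E, hE, h⟩ := exists_countable_forall_finrank_inf_range_eq_of_verdier hGT hf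
  refine ⟨E, hE, fun s hs p t ↦ ?_⟩
  rw [h s hs p, finrank_map_algebraicClasses_eq hf p s t]
  exact finrank_map_le_finrank_inf_range hf t p

/-- **THE JUMP CRITERION, granted Verdier: `(L)_t(p)` ⟺ `dim N_t^{inv} ≤ dim N_s^{inv}` for a very general `s`** —
precisely: there is a countable `E ⊆ S(ℂ)` such that for every `s ∉ E`, every `p` and every `t`, the lift at `t` in
degree `2p` holds iff the invariant algebraic rank at `t` does not exceed (equivalently: equals) that at `s`.
[cite: Verdier1976, Cor. (5.1)] [cite: Milne2020HodgeClassesAV, Prop. 1 (p. 8)] [cite: VoisinHodgeII2003, §3.3.1] -/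
theorem exists_countable_forall_comap_le_sup_iff_finrank_le_of_verdier (hGT : Verdier1976_genericLocalTriviality)
    (hf : IsCompactAbelianPencil f d) :
    ∃ E : Set (ComplexPoints S), E.Countable ∧ ∀ s ∉ E, ∀ (p : ℕ) (t : ComplexPoints S),
      ((algebraicClasses (fiberOver f t) p).comap (complexBetti.map (fiberι f t) (2 * p)).hom ≤
          algebraicClasses 𝒳 p ⊔ LinearMap.ker (complexBetti.map (fiberι f t) (2 * p)).hom ↔
        Module.finrank ℂ ↥(algebraicClasses (fiberOver f t) p ⊓ LinearMap.range (complexBetti.map (fiberι f t) (2 * p)).hom) ≤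
          Module.finrank ℂ ↥(algebraicClasses (fiberOver f s) p ⊓ LinearMap.range (complexBetti.map (fiberι f s) (2 * p)).hom)) := by
  obtain ⟨E, hE, h⟩ := exists_countable_forall_finrank_inf_range_eq_of_verdier hGT hf
  refine ⟨E, hE, fun s hs p t ↦ ?_⟩
  rw [comap_le_sup_iff_finrank_le hf t p, h s hs p, finrank_map_algebraicClasses_eq hf p s t]

/-- The same with EQUALITY of ranks: `(L)_t(p)` ⟺ `dim N_t^{inv} = dim N_s^{inv}` for `s` outside the countable set.
[cite: Verdier1976, Cor. (5.1)] [cite: Milne2020HodgeClassesAV, Prop. 1 (p. 8)] -/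
theorem exists_countable_forall_comap_le_sup_iff_finrank_eq_of_verdier (hGT : Verdier1976_genericLocalTriviality)
    (hf : IsCompactAbelianPencil f d) :
    ∃ E : Set (ComplexPoints S), E.Countable ∧ ∀ s ∉ E, ∀ (p : ℕ) (t : ComplexPoints S),
      ((algebraicClasses (fiberOver f t) p).comap (complexBetti.map (fiberι f t) (2 * p)).hom ≤
          algebraicClasses 𝒳 p ⊔ LinearMap.ker (complexBetti.map (fiberι f t) (2 * p)).hom ↔
        Module.finrank ℂ ↥(algebraicClasses (fiberOver f t) p ⊓ LinearMap.range (complexBetti.map (fiberι f t) (2 * p)).hom) =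
          Module.finrank ℂ ↥(algebraicClasses (fiberOver f s) p ⊓ LinearMap.range (complexBetti.map (fiberι f s) (2 * p)).hom)) := by
  obtain ⟨E, hE, h⟩ := exists_countable_forall_finrank_inf_range_eq_of_verdier hGT hf
  refine ⟨E, hE, fun s hs p t ↦ ?_⟩
  rw [comap_le_sup_iff_finrank_inf_range_eq hf t p, h s hs p, finrank_map_algebraicClasses_eq hf p s t]

/-- **`(L)_t(p)` ⟺ NO JUMP AT `t`: the set of fibres whose invariant algebraic rank differs from that of `𝒳_t` is
COUNTABLE** (granted Verdier). (⟹: off the exceptional set the rank is `r_p(f)`, which is the rank at `t` by (L);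
⟸: a point outside both countable sets has rank `r_p(f)` and the rank of `t`.) [cite: Verdier1976, Cor. (5.1)]
[cite: VoisinHodgeII2003, §3.3.1] [cite: Milne2020HodgeClassesAV, Prop. 1 (p. 8)] -/
theorem comap_le_sup_iff_countable_finrank_ne_of_verdier (hGT : Verdier1976_genericLocalTriviality)
    (hf : IsCompactAbelianPencil f d) (p : ℕ) (t : ComplexPoints S) :
    (algebraicClasses (fiberOver f t) p).comap (complexBetti.map (fiberι f t) (2 * p)).hom ≤
        algebraicClasses 𝒳 p ⊔ LinearMap.ker (complexBetti.map (fiberι f t) (2 * p)).hom ↔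
      {s : ComplexPoints S |
        Module.finrank ℂ ↥(algebraicClasses (fiberOver f s) p ⊓ LinearMap.range (complexBetti.map (fiberι f s) (2 * p)).hom) ≠
          Module.finrank ℂ ↥(algebraicClasses (fiberOver f t) p ⊓
            LinearMap.range (complexBetti.map (fiberι f t) (2 * p)).hom)}.Countable := by
  obtain ⟨E, hE, h⟩ := exists_countable_forall_finrank_inf_range_eq_of_verdier hGT hf
  constructor
  · intro hL
    refine hE.mono fun s hs ↦ ?_
    by_contra hsE
    refine hs ?_
    rw [h s hsE p, finrank_map_algebraicClasses_eq hf p s t]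
    exact ((comap_le_sup_iff_finrank_inf_range_eq hf t p).1 hL).symm
  · intro hc
    obtain ⟨s, hs⟩ := exists_not_mem_of_countable hf t (hE.union hc)
    rw [Set.mem_union, not_or] at hs
    have hst : Module.finrank ℂ ↥(algebraicClasses (fiberOver f s) p ⊓
        LinearMap.range (complexBetti.map (fiberι f s) (2 * p)).hom) =
        Module.finrank ℂ ↥(algebraicClasses (fiberOver f t) p ⊓
          LinearMap.range (complexBetti.map (fiberι f t) (2 * p)).hom) := by
      by_contra hne
      exact hs.2 hne
    rw [comap_le_sup_iff_finrank_inf_range_eq hf t p, ← hst, h s hs.1 p, finrank_map_algebraicClasses_eq hf p s t]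

/-! ## §4 Node level: (L) ⟺ the CM fibres are not jump points; the `HC_CM` reading -/

/-- **(L) ⟺ "CM POINTS ARE NOT JUMP POINTS", granted Verdier**: `CMFibreAlgebraicLift` ⟺ at every CM point `t` of
every compact pencil of abelian varieties and in every degree, the fibres whose invariant algebraic rank differs from
that of `𝒳_t` are countably many. [cite: Verdier1976, Cor. (5.1)] [cite: Andre1996Motifs, §5.1 (p. 25) and §6.3 a) (p. 33)]
[cite: VoisinHodgeII2003, §3.3.1] -/
theorem cmFibreAlgebraicLift_iff_countable_finrank_ne_of_verdier (hGT : Verdier1976_genericLocalTriviality) :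
    CMFibreAlgebraicLift ↔ ∀ ⦃d : ℕ⦄ ⦃𝒳 S : SchemeOver ℂ⦄ (f : 𝒳 ⟶ S), IsCompactAbelianPencil f d →
      ∀ (p : ℕ), ∀ t ∈ cmLocus f d,
        {s : ComplexPoints S |
          Module.finrank ℂ ↥(algebraicClasses (fiberOver f s) p ⊓ LinearMap.range (complexBetti.map (fiberι f s) (2 * p)).hom) ≠
            Module.finrank ℂ ↥(algebraicClasses (fiberOver f t) p ⊓
              LinearMap.range (complexBetti.map (fiberι f t) (2 * p)).hom)}.Countable := by
  rw [cmFibreAlgebraicLift_iff_comap_le_sup]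
  exact ⟨fun h d 𝒳 S f hf p t ht ↦ (comap_le_sup_iff_countable_finrank_ne_of_verdier hGT hf p t).1 (h f hf p t ht),
    fun h d 𝒳 S f hf p t ht ↦ (comap_le_sup_iff_countable_finrank_ne_of_verdier hGT hf p t).2 (h f hf p t ht)⟩

/-- **Under `HC_CM`: `B_min` at a CM point `t` ⟺ the very general invariant ALGEBRAIC rank equals the invariant HODGE
rank of `𝒳_t`** — the set of fibres whose invariant algebraic rank differs from
`dim ((ℂ-span of the rational (p,p)-classes of 𝒳_t) ⊓ Im j_t^*)` is countable (part XXX-d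
`inf_range_eq_hodgeSpan_inf_range_of_HC_CM` for the CM value). `HC_CM` a binder. [cite: Verdier1976, Cor. (5.1)]
[cite: DeligneHodgeII1971, Thm. 4.1.1 and Cor. 4.1.2] [cite: Andre1996Motifs, §6.3 (p. 33)] -/
theorem comap_le_sup_iff_countable_finrank_hodge_ne_of_HC_CM_of_verdier (hGT : Verdier1976_genericLocalTriviality)
    (hCM : RankFourFaces.CMAbelianHodge) (hf : IsCompactAbelianPencil f d) (p : ℕ) {t : ComplexPoints S}
    (ht : t ∈ cmLocus f d) :
    (algebraicClasses (fiberOver f t) p).comap (complexBetti.map (fiberι f t) (2 * p)).hom ≤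
        algebraicClasses 𝒳 p ⊔ LinearMap.ker (complexBetti.map (fiberι f t) (2 * p)).hom ↔
      {s : ComplexPoints S |
        Module.finrank ℂ ↥(algebraicClasses (fiberOver f s) p ⊓ LinearMap.range (complexBetti.map (fiberι f s) (2 * p)).hom) ≠
          Module.finrank ℂ ↥(Submodule.span ℂ {c : complexBetti (fiberOver f t) (2 * p) |
              IsRationalClass c ∧ IsOfHodgeType d (fiberOver f t) (2 * p) p p c} ⊓
            LinearMap.range (complexBetti.map (fiberι f t) (2 * p)).hom)}.Countable := by
  rw [comap_le_sup_iff_countable_finrank_ne_of_verdier hGT hf p t, inf_range_eq_hodgeSpan_inf_range_of_HC_CM hCM hf p ht]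

end Summit.HodgeConjecture.HodgeConjecture.Ring2.AbelianAll

end
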